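import Summits.BirchSwinnertonDyer.BirchSwinnertonDyer.Theorems.KimAtThreeShallowEqDeepNoStubCruxes
import HarnessLib

/-!
# Route `KimAtThreeKolyvagin` (rung W2): the LEAF `N11.KimAtThreeRankZeroPUB`'s conclusion — Kim's rank-0
# `Ш`-length formula at `p = 3` — at EVERY row of the Kato stratum, class-wide, GRANTED [S24] (1)(2), GZK,
# Poitou–Tate (all PUB) and ONE dictionary port; no inline port

Cell `bsd-addord`, seat `bsd-addord-w2-c4` (D-0074 row B7), gen 4; sequel of
`KimAtThreeShallowEqDeepNoStubCruxes` (p444204).  ONE theorem (no definition, no named fact, no `sorry`);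
the three cruxes 19075/19076/19077 and the leaf stay OPEN (they quantify over rows outside the stratum);
nothing asserted about any curve; BSD is not proved by any of this.

WHAT.  `kimAtThreeRankZero_conclusion_classwide_of_ports`: let `W₀` be globally minimal with `3 ∤ c₃(W₀)`,
carrying an OPTIMAL datum `D₀` at the conductor with `3 ∤ c_{D₀}` and the dictionary port PORT″
`KatoKuriharaPortThreeAtWith₂ W₀ 0 v₃ η D₀` (FLAG `K22-Thm3.13-PORT@3`, NOT in print at an additive `3`); let `W`
be ANY globally minimal curve `ℚ`-isogenous to `W₀` with the `3`-adic tower onto, additive at `3`,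
`E(ℚ₃)[3] = 0`; let `f` be any newform of `W` at that level with `3`-integral plus symbols and `ord(δ̃) = 0`.
Then, GRANTED `hS24`/`hS24₂`/GZK/`poitouTate_selmerStructure_duality ℚ`:
`∃ d : ℕ, ∂^{(∞)}(δ̃) = d ∧ ∂⁽⁰⁾(δ̃) = ord₃ #Ш(W)(3) + d` — VERBATIM the conclusion of the rung-W2 leaf
`Summit.BirchSwinnertonDyer.Rank1Residual.Additive.N11.KimAtThreeRankZeroPUB` at `(W, f)`.  Assembly of the
three row-level crux conclusions exactly as `KimAtThreeKolyvaginInputs.kimAtThreeRankZeroPUB_of_inputs`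
(p406491) assembles the three cruxes: (L) w2-c2/kim3's `deepLower_conclusion_classwide_of_ports_of_poitouTate`
(p427395), (U) `deepUpper_conclusion_classwide_noStub`, (S) `shallowEqDeep_conclusion_classwide_noStub`
(p444204), multiplicity one (`IsNewformOf.unique`, `IsNewformOf.of_isIsogenous`) and `ℕ∞` bookkeeping
(`kuriharaPartialInfty_le_kuriharaPartialDeepInfty`).  READING: after the STUB port's discharge
(`KimAtThreeShallowEqDeepStubOfWitnesses`), the route's leaf on the Kato stratum rests on PUB named facts and
PORT″ ALONE; what the leaf still needs beyond PORT″ are the rows OFF the stratum (`3 ∣ c₃`, `3 ∣ c_{D₀}`,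
non-additive `3`).
[cite: Kim2025RefinedTNC, Thm 1.1, Thm 1.2, Cor 1.7] [cite: Kim2022StructureSelmer, Thm. 1.9 (6)]
[cite: Sakamoto2024, Thm. 4.4 (1)(2) (p. 926)] [cite: MazurRubin2004, Thm. 5.2.12] [cite: MilneADT2006, Ch. I, Thm. 4.10]
[cite: Knapp1993, Thm. 11.67] [cite: Carayol1986]
-/

set_option autoImplicit false
-- the Theorems namespace of a single-conjunct summit repeats the summit name by design (D-0017)
set_option linter.dupNamespace false

noncomputable section

open scoped Classical NumberField
open Function Field NumberField IsDedekindDomain WeierstrassCurve CongruenceSubgroup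
  Literature.NumberTheory.EllipticCurves Literature.NumberTheory.EllipticCurves.ModularForms
  Literature.NumberTheory.EllipticCurves.Rank1Residual
  Literature.NumberTheory.GaloisRepresentations Literature.NumberTheory.GaloisCohomology
  Summit.BirchSwinnertonDyer.Rank1Residual.GaloisImage Summit.BirchSwinnertonDyer.Rank1Residual.X4
  Summit.BirchSwinnertonDyer.BirchSwinnertonDyer.Theorems
  Summit.BirchSwinnertonDyer.BirchSwinnertonDyer.Theorems.KimAtThreeKolyvaginIsogenyKatoStratum
  Summit.BirchSwinnertonDyer.BirchSwinnertonDyer.Theorems.KimAtThreeShallowEqDeepNoStubCruxes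

namespace Summit.BirchSwinnertonDyer.BirchSwinnertonDyer.Theorems.KimAtThreeShallowEqDeepNoStubLeafRow

/-- **The leaf `N11.KimAtThreeRankZeroPUB`'s conclusion at every row of the Kato stratum, class-wide,
GRANTED [S24] (1)(2), GZK, Poitou–Tate (PUB) and ONE dictionary port PORT″ — no inline port.**  For `W ~ W₀`
as in the module docstring and ANY newform `f` of `W` at the conductor of `W₀` with `3`-integral plus symbols
and `ord(δ̃_f) = 0`: `∃ d : ℕ, ∂^{(∞)}(δ̃_f) = d ∧ ∂⁽⁰⁾(δ̃_f) = ord₃ #Ш(W)(3) + d` (Kim's rank-`0` `Ш`-length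
formula at `3`, all-levels invariants).  (L)+(U) pin `∂^{(∞)}_deep = d` and `∂⁽⁰⁾ = ord₃ #Ш(3) + d`; (S) with
`∂^{(∞)} ≤ ∂^{(∞)}_deep` gives `∂^{(∞)} = d`. [cite: Kim2025RefinedTNC, Thm 1.1 and Thm 1.2]
[cite: Kim2022StructureSelmer, Thm. 1.9 (6)] [cite: Sakamoto2024, Thm. 4.4 (1)(2) (p. 926)] [cite: MazurRubin2004, Thm. 5.2.12] -/
theorem kimAtThreeRankZero_conclusion_classwide_of_ports
    (hS24 : Sakamoto2024.kolyvaginSystems_freeRankOne_zmod_three_pow)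
    (hS24₂ : Sakamoto2024.kolyvaginSystems_idealOfBasis_eq_fittingIdeal_zmod_three_pow)
    (hGZK : rank_eq_analyticRank_of_analyticRank_le_one)
    (hPT : poitouTate_selmerStructure_duality ℚ)
    (W W₀ : WeierstrassCurve ℚ) [W.IsElliptic] [W.IsGloballyMinimal] [W₀.IsElliptic]
    [W₀.IsGloballyMinimal] (hiso : IsIsogenous W W₀)
    -- the row, read at `W`
    (hadd : haveI : Fact (Nat.Prime 3) := ⟨Nat.prime_three⟩; Addv W 3)
    (htower : ∀ m : ℕ, W.HasSurjectiveModNGaloisRep (3 ^ m : ℕ))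
    (ht0 : Nat.card {Q : (W.baseChange ℚ_[3]).toAffine.Point // (3 : ℕ) • Q = 0} = 1)
    -- the optimal datum of the class, at `W₀`, and the port
    (hc3 : ¬ 3 ∣ (W₀.baseChange ℚ_[3]).localTamagawaNumber ℤ_[3])
    {N : ℕ} [NeZero N] (hN : N = W₀.conductorNorm ℤ) (D₀ : ModularParametrizationData W₀ N)
    (hopt : ∀ z ∈ D₀.L.lattice, ∃ w ∈ periodLattice D₀.f, z = D₀.c * w)
    (hcD : ¬ (3 : ℤ) ∣ D₀.maninConstant)
    (v₃ : HeightOneSpectrum (𝓞 ℚ)) (hv₃ : ((3 : ℕ) : 𝓞 ℚ) ∈ v₃.asIdeal)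
    (η : (q : HeightOneSpectrum (𝓞 ℚ)) → (ZMod (Ideal.absNorm q.asIdeal))ˣ)
    (hη : ∀ q : HeightOneSpectrum (𝓞 ℚ), Subgroup.zpowers (η q) = ⊤)
    (hPort : KatoKuriharaPortThreeAtWith₂ W₀ 0 v₃ η D₀)
    -- any newform of `W` at that level, `3`-integral plus symbols, analytic rank `0`
    (f : CuspForm (Gamma0 N) 2) (hf : IsNewformOf W f)
    (hint : ∀ r : ℚ, ratPlusSymbol f r ≠ 0 → 0 ≤ padicValRat 3 (ratPlusSymbol f r))
    (hord : kuriharaVanishingOrder W 3 f = 0) :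
    ∃ d : ℕ, kuriharaPartialInfty W 3 f = d ∧
      kuriharaPartial W 3 f 0 =
        ((padicValNat 3 (Nat.card (AddCommGroup.primaryComponent W.sha 3)) + d : ℕ) : ℕ∞) := by
  -- multiplicity one: `f = D₀.f` (the class has one newform)
  obtain rfl : f = D₀.f := hf.unique (D₀.isNewformOf.of_isIsogenous hiso)
  -- (L) crux 19075's conclusion at `W` (w2-c2 / kim3, class-wide)
  obtain ⟨d₁, hd₁, hL⟩ := deepLower_conclusion_classwide_of_ports_of_poitouTate hS24 hS24₂ hGZK hPT W W₀ hiso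
    hadd htower ht0 hc3 hN D₀ hopt hcD v₃ hv₃ η hη hPort hord
  -- (U) crux 19076's conclusion at `W` (this seat, no inline port)
  obtain ⟨d₂, hd₂, hU⟩ := deepUpper_conclusion_classwide_noStub hS24 hS24₂ hGZK hPT W W₀ hiso hadd htower ht0
    hc3 D₀ hopt hcD hint v₃ hv₃ η hη hPort hord
  -- (S) crux 19077's conclusion at `W` (this seat, no inline port)
  have hS := shallowEqDeep_conclusion_classwide_noStub hS24 hS24₂ hGZK hPT W W₀ hiso hadd htower ht0 hc3 hN D₀
    hopt hcD hint v₃ hv₃ η hη hPort hord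
  -- bookkeeping in `ℕ∞`
  have h12 : d₁ = d₂ := by
    have h := hd₁.symm.trans hd₂
    exact_mod_cast h
  subst h12
  refine ⟨d₁, le_antisymm ?_ ?_, le_antisymm hL hU⟩
  · exact (kuriharaPartialInfty_le_kuriharaPartialDeepInfty W 3 D₀.f).trans hd₁.le
  · exact hd₁.symm.le.trans hS

end Summit.BirchSwinnertonDyer.BirchSwinnertonDyer.Theorems.KimAtThreeShallowEqDeepNoStubLeafRow

end
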